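import Summits.ABC.IUTFork.LDHLopsidedWitnessPoint
import HarnessLib

/-!
# The fork at [IUTchIII] Corollary 3.12, L-DH level: a LOPSIDED point family on the `λ`-line over `ℚ(i)` —
# II. orders of `j(λ_k)`: a pole of depth `≥ 4k` at `V ∋ π`, good reduction at `W ∋ π̄`, and the local-height budget

Proof-only file (D-0012; 0 definitions, no `Prop` fact) of the abc-iut cell (seat abc-iut-w5-d126, gen 5; row
«HABOVE-LOPSIDED-WITNESS», crux `ThetaPartII` = stmt-ABC-19678, (U) line, VERDICT RISK ¶7). TAKES NO SIDE on [IUTchIII]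
Cor. 3.12 or [IUTchIV] Thm. 1.10; classical arithmetic of the `λ`-line over `ℚ(i)`. Sequel of `LDHLopsidedWitnessPoint`
(`λ_k = π^{2k}/(2π^{2k} + 1)`, `π = 2 + i`, `a = π^{2k}`, `b = 2a + 1`, `c = a + 1`). S. Mochizuki, *IUT IV* [Mochizuki2012],
Cor. 2.2 (i) p. 41 (local heights `h_v = −ord_v(j)`), (ii) proof pp. 45–46 ((P2), (P5)); [IrelandRosen1982] Ch. 9 §7 p. 120;
Dupuy–Hilado [DupuyHilado2025] §2.4.2.

* `le_ord_lam`, **`ord_jInv_V`** / `ord_jInv_V_le` / `mem_badPlaces_V` — for `V ∋ π`, `k ≥ 1`: `ord_V λ_k ≥ 2k` and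
  `ord_V j(λ_k) = −2·ord_V λ_k ≤ −4k` (`|λ_k|_V < 1`, so `|λ_k² − λ_k + 1|_V = |λ_k − 1|_V = |2|_V = 1`): a pole of depth `≥ 4k`;
* **`ord_jInv_W_nonneg`** — for `W ∋ π̄`: `0 ≤ ord_W j(λ_k)` (`λ_k`, `λ_k − 1` are `W`-units): NOT a bad place;
* **`neg_ord_jInv_le`** — at EVERY finite place `U`: `−ord_U j(λ_k) ≤ 2·ord_U(y_k)`, `y_k := a·b·c ∈ 𝓞 F`
  (`j(λ_k)·(abc)² = 2⁸(a² − ab + b²)³` with `a² − ab + b²` integral; no coprimality, no factorisation) — the local-height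
  budget used for (P2) by prime counting in part III; `ord_y_pos_of_ord_jInv_neg` — every pole of `j(λ_k)` divides `y_k`.
HONEST SCOPE: classical; nothing asserted about print. [cite: IrelandRosen1982, Ch. 9 §7 p. 120]
[cite: DupuyHilado2025, §2.4.2] [claim: Mochizuki2012, status: disputed] for every IUT locator quoted.
-/

noncomputable section

namespace Summit.ABC.IUTFork

namespace LopsidedWitness

open NumberField IsDedekindDomain Metric Finset
open Literature.IUT.LogVolume Literature.IUT.LogVolume.Cor22
open Literature.NumberTheory.DiophantineGeometry Literature.NumberTheory.DiophantineGeometry.GenEll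
open Literature.NumberTheory.NumberFields
open SplitBadWitness

variable {F : Type} [Field F] [NumberField F] {ζ : 𝓞 F}

/-! ## Orders at `V ∋ π`: a pole of `j(λ_k)` of depth `2·ord_V λ_k ≥ 4k` -/

/-- `ord_V λ_k ≥ 2k` for `V ∋ π` (`a ∈ V^{2k}`, `b ∉ V`). [cite: DupuyHilado2025, §2.4.2] -/
theorem le_ord_lam [IsCyclotomicExtension {4} ℚ F] (hζ : IsPrimitiveRoot ζ 4) {V : HeightOneSpectrum (𝓞 F)}
    (hV : (2 + ζ : 𝓞 F) ∈ V.asIdeal) {k : ℕ} (hk : 1 ≤ k) :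
    (2 * k : ℤ) ≤ ord F V ((2 + (ζ : F)) ^ (2 * k) / (2 * (2 + (ζ : F)) ^ (2 * k) + 1)) := by
  have ha0 : ((2 + ζ) ^ (2 * k) : 𝓞 F) ≠ 0 := pow_ne_zero _ fun h => piF_ne_zero hζ (by
    rw [← map_ofNat (algebraMap (𝓞 F) F) 2, ← map_add, show (2 : 𝓞 F) + ζ = 0 from h, map_zero])
  have ha : ((2 + ζ) ^ (2 * k) : 𝓞 F) ∈ V.asIdeal ^ (2 * k) := Ideal.pow_mem_pow hV _
  have h1 := SplitDepth.le_ord_coe_of_mem_pow V ha0 ha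
  have h2 := SplitDepth.ord_coe_eq_zero_of_not_mem V (b_notMem_V hV hk)
  rw [coe_pi_pow] at h1
  rw [coe_b] at h2
  rw [div_eq_mul_inv, ord_mul F V (pow_ne_zero _ (piF_ne_zero hζ)) (inv_ne_zero (bF_ne_zero hζ hk)), ord_inv, h2,
    neg_zero, add_zero]
  exact_mod_cast h1

/-- **The pole at `V`**: `ord_V j(λ_k) = −2·ord_V λ_k` for `V ∋ π` (`|λ_k|_V < 1`, so `|λ_k² − λ_k + 1|_V = |λ_k − 1|_V = 1`,
`|2|_V = 1`). [cite: Mochizuki2012, IUTchIV Cor 2.2 (ii) proof (P5) p.46] [claim: Mochizuki2012, status: disputed]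
[cite: DupuyHilado2025, §2.4.2] -/
theorem ord_jInv_V [IsCyclotomicExtension {4} ℚ F] (hζ : IsPrimitiveRoot ζ 4) {V : HeightOneSpectrum (𝓞 F)}
    (hV : (2 + ζ : 𝓞 F) ∈ V.asIdeal) {k : ℕ} (hk : 1 ≤ k) :
    ord F V (jInv ((2 + (ζ : F)) ^ (2 * k) / (2 * (2 + (ζ : F)) ^ (2 * k) + 1))) =
      -2 * ord F V ((2 + (ζ : F)) ^ (2 * k) / (2 * (2 + (ζ : F)) ^ (2 * k) + 1)) := by
  set x := (2 + (ζ : F)) ^ (2 * k) / (2 * (2 + (ζ : F)) ^ (2 * k) + 1) with hx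
  have h2V : (2 : 𝓞 F) ∉ V.asIdeal := two_notMem (five_mem hζ hV)
  have hordx : 0 < ord F V x := lt_of_lt_of_le (by omega) (le_ord_lam hζ hV hk)
  have hx0 : x ≠ 0 := lam_ne_zero hζ hk
  have hvx0 : V.valuation F x ≠ 0 := (V.valuation F).ne_zero_iff.mpr hx0
  -- `|x|_V < 1`
  have hlt : V.valuation F x < 1 := by
    have h : 0 < -WithZero.log (V.valuation F x) := hordx
    have h' : WithZero.log (V.valuation F x) < WithZero.log 1 := by rw [WithZero.log_one]; omega
    exact (WithZero.log_lt_log hvx0 one_ne_zero).mp h'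
  -- strict ultrametric equalities
  have hx1 : V.valuation F (x - 1) = 1 := by
    rw [sub_eq_add_neg, Valuation.map_add_eq_of_lt_right _ (by rw [Valuation.map_neg, map_one]; exact hlt),
      Valuation.map_neg, map_one]
  have hnum : V.valuation F (x ^ 2 - x + 1) = 1 := by
    have hlt' : V.valuation F (x ^ 2 - x) < V.valuation F (1 : F) := by
      rw [map_one]
      exact Valuation.map_sub_lt _ (by rw [map_pow]; exact pow_lt_one₀ zero_le hlt (by norm_num)) hlt
    rw [Valuation.map_add_eq_of_lt_right _ hlt', map_one]
  have hnum0 : x ^ 2 - x + 1 ≠ 0 := fun h0 => by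
    have : V.valuation F (x ^ 2 - x + 1) = 0 := by rw [h0, map_zero]
    rw [hnum] at this; exact one_ne_zero this
  have hl1 : x - 1 ≠ 0 := sub_ne_zero.mpr (lam_ne_one hζ hk)
  have hordnum : ord F V (x ^ 2 - x + 1) = 0 := by unfold ord; rw [hnum, WithZero.log_one, neg_zero]
  have hord1 : ord F V (x - 1) = 0 := by unfold ord; rw [hx1, WithZero.log_one, neg_zero]
  have hord2 : ord F V (2 : F) = 0 := by unfold ord; rw [val_two V h2V, WithZero.log_one, neg_zero]
  have hj : jInv x = (2 ^ 8 * (x ^ 2 - x + 1) ^ 3) * (x ^ 2 * (x - 1) ^ 2)⁻¹ := by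
    unfold jInv; rw [div_eq_mul_inv]
  rw [hj, ord_mul F V (mul_ne_zero (pow_ne_zero _ two_ne_zero) (pow_ne_zero _ hnum0))
      (inv_ne_zero (mul_ne_zero (pow_ne_zero _ hx0) (pow_ne_zero _ hl1))),
    ord_mul F V (pow_ne_zero _ two_ne_zero) (pow_ne_zero _ hnum0), ord_inv,
    ord_mul F V (pow_ne_zero _ hx0) (pow_ne_zero _ hl1), ord_pow, ord_pow, ord_pow, ord_pow, hord2, hordnum, hord1]
  push_cast
  ring

/-- **`V ∋ π` is a bad place of `P_k = (F, λ_k)` with `ord_V j(λ_k) ≤ −4k`.**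
[cite: Mochizuki2012, IUTchIV Cor 2.2 (ii) proof (P5) p.46] [claim: Mochizuki2012, status: disputed] -/
theorem ord_jInv_V_le [IsCyclotomicExtension {4} ℚ F] (hζ : IsPrimitiveRoot ζ 4) {V : HeightOneSpectrum (𝓞 F)}
    (hV : (2 + ζ : 𝓞 F) ∈ V.asIdeal) {k : ℕ} (hk : 1 ≤ k) :
    ord F V (jInv ((2 + (ζ : F)) ^ (2 * k) / (2 * (2 + (ζ : F)) ^ (2 * k) + 1))) ≤ -(2 * (2 * k : ℕ) : ℤ) := by
  rw [ord_jInv_V hζ hV hk]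
  have := le_ord_lam hζ hV hk
  push_cast at this ⊢
  linarith

/-- `V ∋ π` is a bad place of `P_k`. [cite: Mochizuki2012, IUTchIV Cor 2.2 (ii) proof (P5) p.46] [claim: Mochizuki2012, status: disputed] -/
theorem mem_badPlaces_V [IsCyclotomicExtension {4} ℚ F] (hζ : IsPrimitiveRoot ζ 4) {V : HeightOneSpectrum (𝓞 F)}
    (hV : (2 + ζ : 𝓞 F) ∈ V.asIdeal) {k : ℕ} (hk : 1 ≤ k) :
    V ∈ badPlaces (⟨F, (2 + (ζ : F)) ^ (2 * k) / (2 * (2 + (ζ : F)) ^ (2 * k) + 1)⟩ : NFPoint) := by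
  refine (mem_badPlaces_iff_ord_neg (⟨F, (2 + (ζ : F)) ^ (2 * k) / (2 * (2 + (ζ : F)) ^ (2 * k) + 1)⟩ : NFPoint) V).2 ?_
  change ord F V (jInv ((2 + (ζ : F)) ^ (2 * k) / (2 * (2 + (ζ : F)) ^ (2 * k) + 1))) < 0
  have := ord_jInv_V_le hζ hV hk
  push_cast at this
  have hk' : (1 : ℤ) ≤ k := by exact_mod_cast hk
  linarith

/-! ## Orders at `W ∋ π̄`: good reduction -/

/-- **`0 ≤ ord_W j(λ_k)` for `W ∋ π̄`**: `λ_k`, `λ_k − 1` are `W`-units (`a, b, c ∉ W`), `2 ∉ W`.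
[cite: Mochizuki2012, IUTchIV Cor 2.2 (ii) proof (P5) p.46] [claim: Mochizuki2012, status: disputed] [cite: DupuyHilado2025, §2.4.2] -/
theorem ord_jInv_W_nonneg [IsCyclotomicExtension {4} ℚ F] (hζ : IsPrimitiveRoot ζ 4) {W : HeightOneSpectrum (𝓞 F)}
    (hW : (2 - ζ : 𝓞 F) ∈ W.asIdeal) {k : ℕ} (hk : 1 ≤ k) :
    0 ≤ ord F W (jInv ((2 + (ζ : F)) ^ (2 * k) / (2 * (2 + (ζ : F)) ^ (2 * k) + 1))) := by
  set x := (2 + (ζ : F)) ^ (2 * k) / (2 * (2 + (ζ : F)) ^ (2 * k) + 1) with hx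
  have h2W : (2 : 𝓞 F) ∉ W.asIdeal := two_notMem (five_mem' hζ hW)
  have hva : W.valuation F ((2 + (ζ : F)) ^ (2 * k)) = 1 := by
    rw [← coe_pi_pow]; exact val_eq_one_of_notMem W _ (a_notMem_W hζ hW (2 * k))
  have hvb : W.valuation F (2 * (2 + (ζ : F)) ^ (2 * k) + 1) = 1 := by
    rw [← coe_b]; exact val_eq_one_of_notMem W _ (b_notMem_W hζ hW k)
  have hvc : W.valuation F ((2 + (ζ : F)) ^ (2 * k) + 1) = 1 := by
    rw [← coe_c]; exact val_eq_one_of_notMem W _ (c_notMem_W hζ hW k)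
  have hvl : W.valuation F x = 1 := by rw [hx, map_div₀, hva, hvb, div_one]
  have hv1 : W.valuation F (1 - x) = 1 := by rw [hx, one_sub_lam hζ hk, map_div₀, hvc, hvb, div_one]
  have hvl1 : W.valuation F (x - 1) = 1 := by rw [← neg_sub, Valuation.map_neg, hv1]
  have hnum : W.valuation F (x ^ 2 - x + 1) ≤ 1 := by
    refine Valuation.map_add_le _ (Valuation.map_sub_le _ ?_ ?_) (by rw [map_one])
    · rw [map_pow, hvl, one_pow]
    · rw [hvl]
  by_cases hj : jInv x = 0
  · rw [hj, ord_zero]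
  refine ord_nonneg_of_valuation_le_one W hj ?_
  unfold jInv
  rw [map_div₀, map_mul, map_mul, map_pow, map_pow, map_pow, map_pow, val_two W h2W, hvl, hvl1]
  simpa using pow_le_one₀ zero_le hnum

/-! ## The local-height budget: `−ord_U j(λ_k) ≤ 2·ord_U(a·b·c)` at EVERY finite place `U` -/

/-- **At every finite place `U`: `−ord_U j(λ_k) ≤ 2·ord_U(y_k)`**, `y_k = π^{2k}·(2π^{2k}+1)·(π^{2k}+1) ∈ 𝓞 F` —
`j(λ_k) = 2⁸·(a² − ab + b²)³/(a·b·c)²` with `a² − ab + b²` an algebraic integer (`λ_k = a/b`, `λ_k − 1 = −c/b`).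
No coprimality and no factorisation is used. [cite: Mochizuki2012, IUTchIV Cor 2.2 (i) p.41] [claim: Mochizuki2012, status: disputed]
[cite: DupuyHilado2025, §2.4.2] -/
theorem neg_ord_jInv_le [IsCyclotomicExtension {4} ℚ F] (hζ : IsPrimitiveRoot ζ 4) {k : ℕ} (hk : 1 ≤ k)
    (U : HeightOneSpectrum (𝓞 F)) :
    -ord F U (jInv ((2 + (ζ : F)) ^ (2 * k) / (2 * (2 + (ζ : F)) ^ (2 * k) + 1))) ≤
      2 * ord F U ((((2 + ζ) ^ (2 * k) * (2 * (2 + ζ) ^ (2 * k) + 1) * ((2 + ζ) ^ (2 * k) + 1) : 𝓞 F)) : F) := by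
  have hcoe : ((((2 + ζ) ^ (2 * k) * (2 * (2 + ζ) ^ (2 * k) + 1) * ((2 + ζ) ^ (2 * k) + 1) : 𝓞 F)) : F) =
      (2 + (ζ : F)) ^ (2 * k) * (2 * (2 + (ζ : F)) ^ (2 * k) + 1) * ((2 + (ζ : F)) ^ (2 * k) + 1) := by
    simp only [RingOfIntegers.coe_eq_algebraMap, map_add, map_mul, map_one, map_pow, map_ofNat]
  have hy0 : 0 ≤ ord F U ((((2 + ζ) ^ (2 * k) * (2 * (2 + ζ) ^ (2 * k) + 1) * ((2 + ζ) ^ (2 * k) + 1) : 𝓞 F)) : F) :=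
    ord_nonneg_of_isIntegral F U _
  -- the numerator `a² − ab + b²` is an algebraic integer
  have hN0 : 0 ≤ ord F U (((((2 + ζ) ^ (2 * k)) ^ 2 - (2 + ζ) ^ (2 * k) * (2 * (2 + ζ) ^ (2 * k) + 1) +
      (2 * (2 + ζ) ^ (2 * k) + 1) ^ 2 : 𝓞 F)) : F) := ord_nonneg_of_isIntegral F U _
  have hcoeN : (((((2 + ζ) ^ (2 * k)) ^ 2 - (2 + ζ) ^ (2 * k) * (2 * (2 + ζ) ^ (2 * k) + 1) +
      (2 * (2 + ζ) ^ (2 * k) + 1) ^ 2 : 𝓞 F)) : F) =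
      ((2 + (ζ : F)) ^ (2 * k)) ^ 2 - (2 + (ζ : F)) ^ (2 * k) * (2 * (2 + (ζ : F)) ^ (2 * k) + 1) +
        (2 * (2 + (ζ : F)) ^ (2 * k) + 1) ^ 2 := by
    simp only [RingOfIntegers.coe_eq_algebraMap, map_add, map_sub, map_mul, map_one, map_pow, map_ofNat]
  rw [hcoeN] at hN0
  rw [hcoe] at hy0 ⊢
  have h2 : 0 ≤ ord F U (2 : F) := by
    have := ord_nonneg_of_isIntegral F U (2 : 𝓞 F)
    rwa [show (((2 : 𝓞 F)) : F) = 2 from map_ofNat _ 2] at this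
  have hA0 : (2 + (ζ : F)) ^ (2 * k) ≠ 0 := pow_ne_zero _ (piF_ne_zero hζ)
  have hb0 : (2 * (2 + (ζ : F)) ^ (2 * k) + 1) ≠ 0 := bF_ne_zero hζ hk
  have hc0 : ((2 + (ζ : F)) ^ (2 * k) + 1) ≠ 0 := cF_ne_zero hζ hk
  generalize (2 + (ζ : F)) ^ (2 * k) = A at hA0 hb0 hc0 hy0 hN0 ⊢
  -- pure algebra in `A`, `b = 2A + 1`, `c = A + 1`
  set b : F := 2 * A + 1 with hb
  set c : F := A + 1 with hc
  by_cases hj : jInv (A / b) = 0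
  · rw [hj, ord_zero, neg_zero]; linarith
  have hnumne : A ^ 2 - A * b + b ^ 2 ≠ 0 := by
    intro h0
    apply hj
    unfold jInv
    have : (A / b) ^ 2 - A / b + 1 = (A ^ 2 - A * b + b ^ 2) / b ^ 2 := by
      rw [eq_div_iff (pow_ne_zero 2 hb0)]
      field_simp
    rw [this, h0, zero_div]
    simp
  have hcb : A / b - 1 = -(c / b) := by
    rw [div_sub_one hb0, ← neg_div]
    congr 1
    rw [hb, hc]; ring
  have hkey : jInv (A / b) * (A * b * c) ^ 2 = 2 ^ 8 * (A ^ 2 - A * b + b ^ 2) ^ 3 := by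
    unfold jInv
    rw [hcb]
    field_simp
  have hord := congrArg (ord F U) hkey
  rw [ord_mul F U hj (pow_ne_zero _ (mul_ne_zero (mul_ne_zero hA0 hb0) hc0)), ord_pow,
    ord_mul F U (pow_ne_zero _ two_ne_zero) (pow_ne_zero _ hnumne), ord_pow, ord_pow] at hord
  push_cast at hord
  linarith

/-- Hence every pole `U` of `j(λ_k)` divides `y_k`: `0 < ord_U(y_k)`. [cite: DupuyHilado2025, §2.4.2] -/
theorem ord_y_pos_of_ord_jInv_neg [IsCyclotomicExtension {4} ℚ F] (hζ : IsPrimitiveRoot ζ 4) {k : ℕ} (hk : 1 ≤ k)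
    (U : HeightOneSpectrum (𝓞 F))
    (hU : ord F U (jInv ((2 + (ζ : F)) ^ (2 * k) / (2 * (2 + (ζ : F)) ^ (2 * k) + 1))) < 0) :
    0 < ord F U ((((2 + ζ) ^ (2 * k) * (2 * (2 + ζ) ^ (2 * k) + 1) * ((2 + ζ) ^ (2 * k) + 1) : 𝓞 F)) : F) := by
  have := neg_ord_jInv_le hζ hk U
  linarith

end LopsidedWitness

end Summit.ABC.IUTFork

end
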